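import Literature.AlgebraicGeometry.Modules.AffineVectorBundleSections
import Literature.AlgebraicGeometry.Modules.SheafHomAffineSections
import Literature.AlgebraicGeometry.Modules.LocallyFreeTraceCyclic
import Mathlib.RingTheory.Finiteness.Cardinality
import HarnessLib

/-!
# Projective coordinate systems of a vector bundle over an affine open (the dual basis lemma, sheaf form)

Bourbaki, *Algebra* II §2 no. 6, Prop. 12: a module `P` is projective iff there exist families `(a_i)` in `P` and
`(a_i^*)` in `P^*` with `x = ∑_i ⟨x, a_i^*⟩ a_i` for all `x` (for `P` finitely generated the families are finite) —
the "dual basis lemma" / projective coordinate system. Combined with Görtz–Wedhorn I Cor. 7.42 (the sections of a finite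
locally free module over an affine open `W` form a finite projective `Γ(X, W)`-module; the tree's
`finite_projective_sections_of_isFiniteLocallyFree`) and Hartshorne II Prop. 5.2 in the tree's affine-local form
(`Modules/SheafHomAffineSections`: `Hom(F|_W, G|_W) = Hom_{Γ(W)}(Γ(W, F), Γ(W, G))`, `homOfLinear` ∕ `evalHom_injective`), this
gives, for a finite locally free `𝒪_X`-module `F` and an AFFINE open `W ⊆ X`:

* `exists_sum_dual_comp_smulSection_eq_id` — **sections `p_1, …, p_n ∈ Γ(F, W)` and linear forms
  `λ_1, …, λ_n : F|_W → 𝒪|_W` with `∑_i λ_i ≫ (· p_i) = 𝟙_{F|_W}`** as an identity of SHEAF endomorphisms of `F|_W`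
  (`(· p)` = `smulSection p`, `Modules/LocalFrames`);
* `eq_sum_dual_comp_smulSection` — hence every `φ : F|_W → M|_W` is the finite sum of rank-one morphisms
  `∑_i λ_i ≫ (· φ(p_i))`.

No frame of `F` over `W` is assumed (a vector bundle need not be free over an affine open). Everything is proved; no named
facts. Motivation: transitivity of the trace along a finite morphism (`Modules/PushforwardTraceTransitive`).

## References

* N. Bourbaki, *Algebra I, Chapters 1–3* (1989), II §2 no. 6 Prop. 12 (26) (projective modules: dual basis lemma; held text `book:bourbakind-algebra` p. 337). [BourbakiAlgebraI1989]
* U. Görtz, T. Wedhorn, *Algebraic Geometry I* (2nd ed., 2020), Cor. 7.42. [GortzWedhorn2020]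
* R. Hartshorne, *Algebraic Geometry* (1977), II Prop. 5.2 (p. 110). [Hartshorne1977]
-/

noncomputable section

-- `TopCat.Presheaf`/`Scheme.Modules` are not reducible (as in Mathlib's `AlgebraicGeometry/Modules/Tilde.lean`).
set_option backward.isDefEq.respectTransparency false

open CategoryTheory AlgebraicGeometry Opposite TopologicalSpace Limits

namespace Literature.AlgebraicGeometry.Modules

open Literature.AlgebraicGeometry.Motives

universe u

variable {X : Scheme.{u}} {F M : X.Modules} {W : X.Opens}

/-- **Projective coordinate system of a vector bundle over an affine open (dual basis lemma, sheaf form)**: for `F` finite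
locally free and `W` affine there are sections `p_i ∈ Γ(F, W)` and linear forms `λ_i : F|_W → 𝒪|_W` (`i < n`) with
`∑_i λ_i ≫ (· p_i) = 𝟙_{F|_W}`. Proof: `Γ(F, W)` is finite projective over `Γ(X, W)` (Görtz–Wedhorn I Cor. 7.42), so a
surjection `Γ(X, W)^n → Γ(F, W)` splits (Bourbaki A II §2 no. 6 Prop. 12); the coordinate forms extend to sheaf morphisms
`F|_W → 𝒪|_W` (Hartshorne II 5.2, `homOfLinear`), and two endomorphisms of `F|_W` agreeing on `W`-sections are equal
(`evalHom_injective`). [cite: BourbakiAlgebraI1989, II §2 no. 6 Prop. 12 (26)] [cite: GortzWedhorn2020, Cor. 7.42] [cite: Hartshorne1977, II Prop. 5.2 (p. 110)] -/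
theorem exists_sum_dual_comp_smulSection_eq_id (hF : IsFiniteLocallyFree F) (hW : IsAffineOpen W) :
    ∃ (n : ℕ) (p : Fin n → Γ(F, W)) (lam : Fin n → (F.over W ⟶ (unitModule X).over W)),
      ∑ i, lam i ≫ smulSection (p i) = 𝟙 (F.over W) := by
  classical
  obtain ⟨hfin, hproj⟩ := finite_projective_sections_of_isFiniteLocallyFree hF hW
  obtain ⟨n, f, hf⟩ := Module.Finite.exists_fin' Γ(X, W) Γ(F, W)
  obtain ⟨h, hh⟩ := Module.projective_lifting_property f LinearMap.id hf
  haveI := hF.isVectorBundle.1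
  have hP : IsAffineLocalizing F := IsAffineLocalizing.of_isQuasicoherent F
  -- the generators `p_i = f(e_i)` and the coordinate forms `λ_i = pr_i ∘ h`, extended to `F|_W → 𝒪|_W`
  let e : Fin n → (Fin n → Γ(X, W)) := fun i j => if i = j then 1 else 0
  let l : Fin n → (Γ(F, W) →ₗ[Γ(X, W)] Γ(unitModule X, W)) := fun i =>
    show Γ(F, W) →ₗ[Γ(X, W)] Γ(unitModule X, W) from (LinearMap.proj i).comp h
  refine ⟨n, fun i => f (e i), fun i => homOfLinear hP hW (l i), ?_⟩
  apply evalHom_injective hP hW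
  refine LinearMap.ext fun m => ?_
  rw [evalHom_apply, evalHom_apply, appLE_id, appLE_sum]
  have hl : ∀ i, appLE (homOfLinear hP hW (l i)) (𝟙 W) m = (h m i : Γ(X, W)) := by
    intro i
    have := LinearMap.congr_fun (evalHom_homOfLinear hP hW (l i)) m
    rw [evalHom_apply] at this
    exact this
  have hs : ∀ i, appLE (homOfLinear hP hW (l i) ≫ smulSection (f (e i))) (𝟙 W) m = h m i • f (e i) := by
    intro i
    rw [appLE_comp, appLE_smulSection, presheaf_map_id, hl]
  simp_rw [hs]
  -- `∑_i (h m)_i • f(e_i) = f(∑_i (h m)_i • e_i) = f(h m) = m`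
  calc ∑ i, h m i • f (e i) = f (∑ i, h m i • e i) := by rw [map_sum]; simp_rw [map_smul]
    _ = f (h m) := by rw [← pi_eq_sum_univ (h m)]
    _ = m := LinearMap.congr_fun hh m

/-- **Every morphism out of a vector bundle over an affine open is a finite sum of rank-one morphisms**:
`φ = ∑_i λ_i ≫ (· φ(p_i))` for any projective coordinate system `(p_i, λ_i)` of `F|_W`.
[cite: BourbakiAlgebraI1989, II §2 no. 6 Prop. 12 (26)] [cite: GortzWedhorn2020, Cor. 7.42] -/
theorem eq_sum_dual_comp_smulSection {n : ℕ} {p : Fin n → Γ(F, W)} {lam : Fin n → (F.over W ⟶ (unitModule X).over W)}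
    (hid : ∑ i, lam i ≫ smulSection (p i) = 𝟙 (F.over W)) (φ : F.over W ⟶ M.over W) :
    φ = ∑ i, lam i ≫ smulSection (appLE φ (𝟙 W) (p i)) := by
  conv_lhs => rw [← Category.id_comp φ, ← hid, Preadditive.sum_comp]
  refine Finset.sum_congr rfl fun i _ => ?_
  rw [Category.assoc, smulSection_comp]

end Literature.AlgebraicGeometry.Modules

end
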